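import Literature.NumberTheory.CubicFields.DeloneFaddeevIrreducible
import Mathlib.NumberTheory.NumberField.Basic
import Mathlib.RingTheory.Localization.FractionRing
import HarnessLib

/-!
# `R(f)` is an order in the cubic field `ℚ[x]/(f(x,1))` for irreducible `f` (Levi–Delone–Faddeev)

Topic `Literature/NumberTheory/CubicFields`, continuing `DeloneFaddeevIrreducible.lean`
(`BinaryCubic.IsIrreducible`, `RatAlgebra f = ℚ[x]/(f(x,1))`, the injective ring homomorphism
`RingOfForm.toAdjoinRoot : R(f) → ℚ[x]/(f(x,1))`, `ω ↦ −aα`, `θ ↦ −(aα² + bα + c)`, and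
`R(f)` integral domain `↔ f` irreducible).

Bhargava–Taniguchi–Thorne 2023, Thm 2.1, clause 2: "irreducible cubic forms correspond to ORDERS
IN CUBIC FIELDS". This file supplies the field: for `f` irreducible over `ℚ`,

* `RingOfForm.finrank_ratAlgebra` — `ℚ[x]/(f(x,1))` has degree `3` over `ℚ` (for `a ≠ 0`);
* the instances (under `[Fact f.IsIrreducible]`) `Field`, `CharZero`, `FiniteDimensional ℚ`,
  **`NumberField (RatAlgebra f)`** — `K_f = ℚ[x]/(f(x,1))` is a cubic number field;
* `RingOfForm.algebraRatAlgebra` — `K_f` as an `R(f)`-algebra through `toAdjoinRoot`, and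
  `RingOfForm.exists_int_mul_eq` — **every element of `K_f` is `r / n` with `r ∈ R(f)`, `n ∈ ℤ ∖ 0`**
  (`R(f)` has full rank in `K_f`);
* **`RingOfForm.isFractionRing_ratAlgebra : IsFractionRing R(f) K_f`** — `K_f = Frac R(f)`, so
  `R(f)` (free of rank `3 = [K_f : ℚ]`, a subring) is an order in the cubic field `K_f`.

## References

* M. Bhargava, T. Taniguchi, F. Thorne, *Improved error estimates for the Davenport–Heilbronn
  theorems*, Math. Ann. 389 (2024) = arXiv:2107.12819, §2.1 and Thm 2.1 [BhargavaTaniguchiThorne2023].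
* B. N. Delone, D. K. Faddeev, *The theory of irrationalities of the third degree*, Transl. Math.
  Monographs 10, AMS (1964), §15.
* W. T. Gan, B. Gross, G. Savin, *Fourier coefficients of modular forms on `G₂`*, Duke Math. J.
  115 (2002), §4 [GanGrossSavin2002].
-/

namespace Literature.NumberTheory.CubicFields

open Polynomial BinaryCubic

namespace RingOfForm

variable {f : BinaryCubic ℤ}

/-! ### The cubic algebra `K_f = ℚ[x]/(f(x,1))` -/

/-- **`[K_f : ℚ] = 3`** for `a ≠ 0`. [folklore] -/
theorem finrank_ratAlgebra (ha : f.a ≠ 0) : Module.finrank ℚ (RatAlgebra f) = 3 := by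
  rw [(AdjoinRoot.powerBasis (ratPoly_ne_zero ha)).finrank, AdjoinRoot.powerBasis_dim,
    natDegree_ratPoly ha]

/-- `K_f` is finite-dimensional over `ℚ` (for `a ≠ 0`). [folklore] -/
theorem finite_ratAlgebra (ha : f.a ≠ 0) : Module.Finite ℚ (RatAlgebra f) :=
  (AdjoinRoot.powerBasis (ratPoly_ne_zero ha)).finite

/-- Every element of `K_f` is `q₀ + q₁ α + q₂ α²` with rational `qᵢ` (for `a ≠ 0`). [folklore] -/
theorem exists_eq_quadratic (ha : f.a ≠ 0) (z : RatAlgebra f) :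
    ∃ q₀ q₁ q₂ : ℚ, z = algebraMap ℚ _ q₀ + algebraMap ℚ _ q₁ * AdjoinRoot.root f.ratPoly
      + algebraMap ℚ _ q₂ * AdjoinRoot.root f.ratPoly ^ 2 := by
  haveI : Nontrivial (RatAlgebra f) := AdjoinRoot.nontrivial _ (by
    rw [degree_ratPoly ha]; decide)
  obtain ⟨q, hq, hz⟩ := (AdjoinRoot.powerBasis (ratPoly_ne_zero ha)).exists_eq_aeval z
  rw [AdjoinRoot.powerBasis_dim, natDegree_ratPoly ha] at hq
  refine ⟨q.coeff 0, q.coeff 1, q.coeff 2, ?_⟩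
  rw [hz, AdjoinRoot.powerBasis_gen, aeval_eq_sum_range' hq]
  simp [Finset.sum_range_succ, Algebra.smul_def]

section Irreducible

variable [hf : Fact f.IsIrreducible]

/-- For irreducible `f`, `f(u,1)` is irreducible (instance form, making `K_f` a field). [folklore] -/
instance : Fact (Irreducible f.ratPoly) := ⟨hf.out.2⟩

/-- `K_f` is a field for irreducible `f` (Mathlib's `AdjoinRoot.instField`). [folklore] -/
noncomputable example : Field (RatAlgebra f) := inferInstance

/-- `K_f` has characteristic zero. [folklore] -/
instance : CharZero (RatAlgebra f) :=
  charZero_of_injective_algebraMap (algebraMap ℚ (RatAlgebra f)).injective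

/-- `K_f` is finite-dimensional over `ℚ`. [folklore] -/
instance : FiniteDimensional ℚ (RatAlgebra f) := finite_ratAlgebra hf.out.1

/-- **`K_f = ℚ[x]/(f(x,1))` is a number field** (of degree `3`, `finrank_ratAlgebra`) for `f`
irreducible over `ℚ` — the cubic field of BTT Thm 2.1, clause 2. [cite: BhargavaTaniguchiThorne2023, Theorem 2.1 (orders in cubic fields)] -/
instance : NumberField (RatAlgebra f) where

/-- The degree of the cubic field `K_f`. [folklore] -/
theorem finrank_ratAlgebra_eq_three : Module.finrank ℚ (RatAlgebra f) = 3 :=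
  finrank_ratAlgebra hf.out.1

end Irreducible

/-! ### `K_f` as an `R(f)`-algebra and `Frac R(f) = K_f` -/

/-- `K_f` as an algebra over `R(f)` through the embedding `toAdjoinRoot`. [folklore] -/
noncomputable instance algebraRatAlgebra (f : BinaryCubic ℤ) : Algebra (RingOfForm f) (RatAlgebra f) :=
  (toAdjoinRoot f).toAlgebra

/-- The structure map is `toAdjoinRoot`. [folklore] -/
theorem algebraMap_ratAlgebra_eq (f : BinaryCubic ℤ) :
    algebraMap (RingOfForm f) (RatAlgebra f) = toAdjoinRoot f := rfl

/-- **`R(f)` has full rank in `K_f`**: for `a ≠ 0`, every `z ∈ K_f` satisfies `n z = ι(r)` for some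
`r ∈ R(f)` and some nonzero integer `n` (indeed `n = a² N` with `N` a common denominator of the
coordinates of `z` on `1, α, α²`, using `aα = −ι(ω)`, `a²α² = −a ι(θ) + b ι(ω) − ac`). [folklore] -/
theorem exists_int_mul_eq (ha : f.a ≠ 0) (z : RatAlgebra f) :
    ∃ r : RingOfForm f, ∃ n : ℤ, n ≠ 0 ∧ (n : RatAlgebra f) * z = toAdjoinRoot f r := by
  obtain ⟨q₀, q₁, q₂, hz⟩ := exists_eq_quadratic ha z
  -- a common denominator
  set N : ℤ := (q₀.den : ℤ) * q₁.den * q₂.den with hN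
  have hN0 : N ≠ 0 := by
    simp only [hN]
    exact mul_ne_zero (mul_ne_zero (by exact_mod_cast q₀.den_nz) (by exact_mod_cast q₁.den_nz))
      (by exact_mod_cast q₂.den_nz)
  set m₀ : ℤ := q₀.num * q₁.den * q₂.den with hm₀
  set m₁ : ℤ := q₀.den * q₁.num * q₂.den with hm₁
  set m₂ : ℤ := q₀.den * q₁.den * q₂.num with hm₂
  have h₀ : (N : ℚ) * q₀ = m₀ := by
    simp only [hN, hm₀]; push_cast
    linear_combination ((q₁.den : ℚ) * q₂.den) * Rat.mul_den_eq_num q₀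
  have h₁ : (N : ℚ) * q₁ = m₁ := by
    simp only [hN, hm₁]; push_cast
    linear_combination ((q₀.den : ℚ) * q₂.den) * Rat.mul_den_eq_num q₁
  have h₂ : (N : ℚ) * q₂ = m₂ := by
    simp only [hN, hm₂]; push_cast
    linear_combination ((q₀.den : ℚ) * q₁.den) * Rat.mul_den_eq_num q₂
  -- `a² N z = ι(a² m₀ − ac m₂, −a m₁ + b m₂, −a m₂)`
  refine ⟨⟨f.a ^ 2 * m₀ - f.a * f.c * m₂, -(f.a * m₁) + f.b * m₂, -(f.a * m₂)⟩, f.a ^ 2 * N,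
    mul_ne_zero (pow_ne_zero 2 ha) hN0, ?_⟩
  set α := AdjoinRoot.root f.ratPoly
  have e₀ : (algebraMap ℚ (RatAlgebra f)) q₀ * (N : RatAlgebra f) = (m₀ : RatAlgebra f) := by
    rw [mul_comm, ← map_intCast (algebraMap ℚ (RatAlgebra f)) N, ← map_mul, h₀, map_intCast]
  have e₁ : (algebraMap ℚ (RatAlgebra f)) q₁ * (N : RatAlgebra f) = (m₁ : RatAlgebra f) := by
    rw [mul_comm, ← map_intCast (algebraMap ℚ (RatAlgebra f)) N, ← map_mul, h₁, map_intCast]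
  have e₂ : (algebraMap ℚ (RatAlgebra f)) q₂ * (N : RatAlgebra f) = (m₂ : RatAlgebra f) := by
    rw [mul_comm, ← map_intCast (algebraMap ℚ (RatAlgebra f)) N, ← map_mul, h₂, map_intCast]
  rw [toAdjoinRoot_apply, hz]
  push_cast
  linear_combination ((f.a : RatAlgebra f) ^ 2) * e₀ + ((f.a : RatAlgebra f) ^ 2 * α) * e₁
    + ((f.a : RatAlgebra f) ^ 2 * α ^ 2) * e₂

/-- **`K_f` is the field of fractions of `R(f)`** for `f` irreducible over `ℚ`: `R(f) ↪ K_f` is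
injective (`toAdjoinRoot_injective`) with full rank (`exists_int_mul_eq`). Hence `R(f)` — a
subring, free of rank `3 = [K_f : ℚ]` — is an ORDER in the cubic field `K_f` (BTT 2023, Thm 2.1,
clause 2: "irreducible cubic forms correspond to orders in cubic fields"). [cite: BhargavaTaniguchiThorne2023, Theorem 2.1 (irreducible forms ↔ orders in cubic fields)] -/
theorem isFractionRing_ratAlgebra [hf : Fact f.IsIrreducible] : IsFractionRing (RingOfForm f) (RatAlgebra f) := by
  have ha : f.a ≠ 0 := hf.out.1
  haveI : IsDomain (RingOfForm f) := isDomain_of_isIrreducible hf.out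
  have hinj : Function.Injective (algebraMap (RingOfForm f) (RatAlgebra f)) := toAdjoinRoot_injective ha
  rw [IsFractionRing, isLocalization_iff]
  refine ⟨?_, ?_, ?_⟩
  · -- nonzero elements of `R(f)` become units of the field `K_f`
    intro y
    have hy : (y : RingOfForm f) ≠ 0 := nonZeroDivisors.ne_zero y.2
    exact isUnit_iff_ne_zero.mpr fun h => hy (hinj (by rw [h, map_zero]))
  · -- every element is `r / n`
    intro z
    obtain ⟨r, n, hn, h⟩ := exists_int_mul_eq ha z
    have hn' : (n : RingOfForm f) ≠ 0 := by
      intro h0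
      apply hn
      simpa using congrArg RingOfForm.x h0
    refine ⟨⟨r, ⟨(n : RingOfForm f), mem_nonZeroDivisors_of_ne_zero hn'⟩⟩, ?_⟩
    change z * algebraMap (RingOfForm f) (RatAlgebra f) (n : RingOfForm f) = algebraMap _ _ r
    rw [map_intCast, mul_comm]
    exact h
  · -- injectivity
    intro x y hxy
    exact ⟨1, by rw [hinj hxy]⟩

/-- The same with the irreducibility hypothesis explicit. [folklore] -/
theorem isFractionRing_ratAlgebra_of_isIrreducible (h : f.IsIrreducible) :
    IsFractionRing (RingOfForm f) (RatAlgebra f) :=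
  @isFractionRing_ratAlgebra f ⟨h⟩

end RingOfForm

end Literature.NumberTheory.CubicFields
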